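import Literature.AlgebraicGeometry.HodgeTheory.ProjPowerMap
import Literature.AlgebraicGeometry.HodgeTheory.FermatHypersurfaceReduction
import HarnessLib

/-!
# The level map `π : Xⁿ_{km} ⟶ Xⁿₘ`, `[xᵢ] ↦ [xᵢᵏ]`, of the Fermat hypersurfaces

Family `hodge`, layer `Literature/AlgebraicGeometry/HodgeTheory`. Sequel of `HodgeTheory/ProjPowerMap`
(the power map `[x] ↦ [xᵏ]` of `ℙⁿ⁺¹_ℂ`, glued over the standard charts). For `k, m ≥ 1` the power
map pulls `D₊(Σ xᵢᵐ)` back to `D₊(Σ xᵢ^{km})` (`ProjPowerMap.powerMap_preimage_basicOpen`), hence maps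
the standard model `Xⁿ_{km} = V₊(Σ xᵢ^{km})` of the Fermat variety (`fermatHypersurface n (k * m)`,
file `FermatHypersurfaceReduction`) into `Xⁿₘ = V₊(Σ xᵢᵐ)`; lifting to the reduced induced
structures (`Motives.liftOfRangeSubset`, Hartshorne II Ex. 3.11 (d)) gives the **level map**
`fermatLevelMap n hk hm : fermatHypersurface n (k * m) ⟶ fermatHypersurface n m` over `ℂ` — the
quotient map `Xⁿ_{km} → Xⁿ_{km}/(μₖ)ⁿ⁺² ≅ Xⁿₘ` of the inductive structure of Fermat varieties
(Shioda–Katsura, Tôhoku Math. J. 31 (1979) §1; Shioda, Math. Ann. 245 (1979) §1). PROVED here: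

* `expand_fermatPolynomial` — `φ(Σ xᵢᵐ) = Σ xᵢ^{km}` for `φ = (xᵢ ↦ xᵢᵏ)`;
* `fermatLevelMap`, `fermatLevelMap_comp_ι` — the level map and its compatibility with the
  embeddings into `ℙⁿ⁺¹_ℂ`;
* **`hypersurfacePoint_map_fermatLevelMap`: `π` acts as `[z] ↦ [(zᵢᵏ)ᵢ]` on the homogeneous
  coordinates of complex points**, and the representative form
  `exists_rep_hypersurfacePoint_map_fermatLevelMap` / `exists_fermatLevelMap` — literally the inputs
  (M1) (the morphism) and (M2) (the points formula) of
  `Summit…CancelByAnyClaimLattice.stub_claimLevelPull_of_levelMap` and `stub_claimLevelPush_of_levelMap`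
  (functoriality of Aoki's claim under change of level).

Not treated here: flatness of `π` (finite surjective between smooth varieties of the same dimension:
miracle flatness, Matsumura Thm. 23.1) and the transfer `H*(Xⁿ_{km}(ℂ); ℂ)^K = π^* H*(Xⁿₘ(ℂ); ℂ)`
for the finite (non-free) quotient by `K = ker (μ_{km}ⁿ⁺² → μₘⁿ⁺²)`.

## References

* [ShiodaKatsura1979] T. Shioda, T. Katsura, *On Fermat varieties*, Tôhoku Math. J. 31 (1979), §1.
* [Hartshorne1977] R. Hartshorne, *Algebraic Geometry* (1977), II Ex. 2.14, II Ex. 3.11 (d).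
-/

noncomputable section

open CategoryTheory AlgebraicGeometry MvPolynomial
open scoped LinearAlgebra.Projectivization

namespace Literature.AlgebraicGeometry.HodgeTheory

/-! ### The level map of the Fermat hypersurfaces `Xⁿ_{km} → Xⁿₘ` -/

section Fermat

open Literature.AlgebraicGeometry.Motives Literature.NumberTheory.Transcendental ProjPowerMap

attribute [local instance] MvPolynomial.gradedAlgebra

variable {n m k : ℕ}

/-- The grading of `ℂ[x₀, …, x_{n+1}]` by degree (local notation). [folklore] -/
local notation "𝓐" => MvPolynomial.homogeneousSubmodule (Fin (n + 2)) ℂ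

variable (n m k) in
/-- `φ(Σ xᵢᵐ) = Σ xᵢ^{k m}`: the substitution `xᵢ ↦ xᵢᵏ` carries the Fermat form of degree `m` to the
Fermat form of degree `k m`. [cite: ShiodaKatsura1979, §1] -/
theorem expand_fermatPolynomial :
    expand k (fermatPolynomial ℂ n m) = fermatPolynomial ℂ n (k * m) := by
  simp only [fermatPolynomial, map_sum, map_pow, expand_X, ← pow_mul]

/-- The power map `[x] ↦ [xᵏ]` maps `V₊(Σ xᵢ^{km})` into `V₊(Σ xᵢᵐ)` (it pulls `D₊(Σ xᵢᵐ)` back to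
`D₊(Σ xᵢ^{km})`), `m ≥ 1`. [cite: ShiodaKatsura1979, §1] -/
theorem range_ι_comp_projPowerMap_subset (hk : 0 < k) (hm : 0 < m) :
    Set.range ((SmoothHypersurface.hypersurfaceι (fermatPolynomial ℂ n (k * m))).left ≫
        (projPowerMap n hk).left) ⊆
      Set.range (SmoothHypersurface.hypersurfaceι (fermatPolynomial ℂ n m)).left := by
  rintro _ ⟨x, rfl⟩
  have hx : (SmoothHypersurface.hypersurfaceι (fermatPolynomial ℂ n (k * m))).left x ∈
      ProjectiveSpectrum.zeroLocus 𝓐 {fermatPolynomial ℂ n (k * m)} :=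
    (Set.ext_iff.mp (SmoothHypersurface.range_hypersurfaceι (fermatPolynomial ℂ n (k * m))) _).mp ⟨x, rfl⟩
  rw [mem_zeroLocus_iff_notMem_basicOpen] at hx
  refine (Set.ext_iff.mp (SmoothHypersurface.range_hypersurfaceι (fermatPolynomial ℂ n m)) _).mpr
    ((mem_zeroLocus_iff_notMem_basicOpen (fermatPolynomial ℂ n m) _).mpr fun h ↦ hx ?_)
  have h' : (SmoothHypersurface.hypersurfaceι (fermatPolynomial ℂ n (k * m))).left x ∈
      (projPowerMap n hk).left ⁻¹ᵁ Proj.basicOpen 𝓐 (fermatPolynomial ℂ n m) := h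
  rwa [projPowerMap_preimage_basicOpen hk hm (isHomogeneous_fermatPolynomial n m),
    expand_fermatPolynomial] at h'

variable (n) in
/-- **The level map `π : Xⁿ_{km} ⟶ Xⁿₘ` of the Fermat hypersurfaces**, `[xᵢ] ↦ [xᵢᵏ]` (`k, m ≥ 1`): the
restriction of the power map of `ℙⁿ⁺¹_ℂ` to the standard models `V₊(Σ xᵢ^{km}) → V₊(Σ xᵢᵐ)`, lifted to
the reduced induced structures by their universal property (`Motives.liftOfRangeSubset`); a morphism
over `ℂ`. This is the quotient map `Xⁿ_{km} → Xⁿ_{km}/(μₖ)ⁿ⁺² ≅ Xⁿₘ` of Shioda–Katsura.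
[cite: ShiodaKatsura1979, §1] [cite: Hartshorne1977, II Ex. 3.11 (d)] -/
def fermatLevelMap (hk : 0 < k) (hm : 0 < m) : fermatHypersurface n (k * m) ⟶ fermatHypersurface n m :=
  Over.homMk (liftOfRangeSubset (SmoothHypersurface.hypersurfaceι (fermatPolynomial ℂ n m)).left
    ((SmoothHypersurface.hypersurfaceι (fermatPolynomial ℂ n (k * m))).left ≫ (projPowerMap n hk).left)
    (range_ι_comp_projPowerMap_subset hk hm)) (by
      rw [← Over.w (SmoothHypersurface.hypersurfaceι (fermatPolynomial ℂ n m)),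
        liftOfRangeSubset_comp_assoc, Category.assoc, Over.w (projPowerMap n hk),
        Over.w (SmoothHypersurface.hypersurfaceι (fermatPolynomial ℂ n (k * m)))])

/-- `fermatLevelMap` followed by `Xⁿₘ ↪ ℙⁿ⁺¹` is `Xⁿ_{km} ↪ ℙⁿ⁺¹` followed by the power map
(underlying schemes). [folklore] -/
@[reassoc]
theorem fermatLevelMap_left_comp_ι (hk : 0 < k) (hm : 0 < m) :
    (fermatLevelMap n hk hm).left ≫ (SmoothHypersurface.hypersurfaceι (fermatPolynomial ℂ n m)).left =
      (SmoothHypersurface.hypersurfaceι (fermatPolynomial ℂ n (k * m))).left ≫ (projPowerMap n hk).left :=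
  liftOfRangeSubset_comp _ _ (range_ι_comp_projPowerMap_subset hk hm)

/-- The same over `ℂ`. [folklore] -/
@[reassoc]
theorem fermatLevelMap_comp_ι (hk : 0 < k) (hm : 0 < m) :
    fermatLevelMap n hk hm ≫ SmoothHypersurface.hypersurfaceι (fermatPolynomial ℂ n m) =
      SmoothHypersurface.hypersurfaceι (fermatPolynomial ℂ n (k * m)) ≫ projPowerMap n hk := by
  ext : 1
  rw [Over.comp_left, Over.comp_left]
  exact fermatLevelMap_left_comp_ι hk hm

/-- **The level map acts as `[z] ↦ [(zᵢᵏ)ᵢ]` on homogeneous coordinates of complex points.**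
[cite: ShiodaKatsura1979, §1] -/
theorem hypersurfacePoint_map_fermatLevelMap (hk : 0 < k) (hm : 0 < m)
    (x : ComplexPoints (fermatHypersurface n (k * m))) :
    hypersurfacePoint (SmoothHypersurface.hypersurfaceι (fermatPolynomial ℂ n m))
        (AlgPoints.map (fermatLevelMap n hk hm) x) =
      Projectivization.mk ℂ
        (fun i ↦ (hypersurfacePoint (SmoothHypersurface.hypersurfaceι (fermatPolynomial ℂ n (k * m))) x).rep i ^ k)
        (pow_vec_ne_zero (Projectivization.rep_nonzero _) k) := by
  refine hypersurfacePoint_eq_of_projPoint_eq _ _ ?_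
  rw [← map_projPowerMap_projPoint hk _ (Projectivization.rep_nonzero _), Projectivization.mk_rep,
    projPoint_hypersurfacePoint]
  change _ = (AlgPoints.map (SmoothHypersurface.hypersurfaceι (fermatPolynomial ℂ n m)) ∘
    AlgPoints.map (fermatLevelMap n hk hm)) x
  rw [← AlgPoints.map_comp, fermatLevelMap_comp_ι, AlgPoints.map_comp, Function.comp_apply]

/-- **The points formula of the level map** (input (M2) of `stub_claimLevelPull_of_levelMap` /
`stub_claimLevelPush_of_levelMap`): the chosen homogeneous coordinates of `π(x)` are a scalar
multiple of `(zᵢᵏ)ᵢ`, `[z]` those of `x`. [cite: ShiodaKatsura1979, §1] -/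
theorem exists_rep_hypersurfacePoint_map_fermatLevelMap (hk : 0 < k) (hm : 0 < m)
    (x : ComplexPoints (fermatHypersurface n (k * m))) :
    ∃ t : ℂ, (hypersurfacePoint (SmoothHypersurface.hypersurfaceι (fermatPolynomial ℂ n m))
        (AlgPoints.map (fermatLevelMap n hk hm) x)).rep =
      t • fun i ↦ (hypersurfacePoint (SmoothHypersurface.hypersurfaceι (fermatPolynomial ℂ n (k * m))) x).rep i ^ k := by
  rw [hypersurfacePoint_map_fermatLevelMap]
  obtain ⟨u, hu⟩ := Projectivization.exists_smul_eq_mk_rep ℂ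
    (fun i ↦ (hypersurfacePoint (SmoothHypersurface.hypersurfaceι (fermatPolynomial ℂ n (k * m))) x).rep i ^ k)
    (pow_vec_ne_zero (Projectivization.rep_nonzero _) k)
  exact ⟨u, by rw [← hu, Units.smul_def]⟩

/-- **(M1) + (M2) packaged**: for all `m, k ≥ 1` and `n` there is a morphism
`π : Xⁿ_{km} ⟶ Xⁿₘ` of the standard models whose homogeneous coordinates are a scalar multiple of
`(zᵢᵏ)ᵢ` — the first two inputs of `stub_claimLevelPull_of_levelMap`. [cite: ShiodaKatsura1979, §1] -/
theorem exists_fermatLevelMap (n m k : ℕ) (hm : 0 < m) (hk : 0 < k) :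
    ∃ π : fermatHypersurface n (k * m) ⟶ fermatHypersurface n m,
      ∀ x, ∃ t : ℂ, (hypersurfacePoint (SmoothHypersurface.hypersurfaceι (fermatPolynomial ℂ n m))
          (AlgPoints.map π x)).rep =
        t • fun i ↦ (hypersurfacePoint (SmoothHypersurface.hypersurfaceι (fermatPolynomial ℂ n (k * m))) x).rep i ^ k :=
  ⟨fermatLevelMap n hk hm, exists_rep_hypersurfacePoint_map_fermatLevelMap hk hm⟩

end Fermat

end Literature.AlgebraicGeometry.HodgeTheory

end
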